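import Summits.HodgeConjecture.HodgeConjecture.Theorems.Ring2AbelianAllAndreWeightLiftExact
import Summits.HodgeConjecture.HodgeConjecture.Theorems.Ring2AbelianAllAndreSpreadVerdier
import HarnessLib

/-!
# Ring 2 · sub-cell AbelianAll (ALL ABELIAN VARIETIES), André axis, part XXIV-c — LERAY WEIGHTS at node level:
# `HC_AV ⟺ HC_CM ∧ [the canonical lifts of the algebraic classes of the CM fibres are algebraic]` (mod [h₂₁, Verdier, weights])

HONEST FRAMING (page 1, verbatim): **research route, not a corollary; conditional on HC_CM plus one named
minimal statement.** Cell line: research route conditional on HC_CM; not a corollary; Q11.4-sentence-2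
already refuted in dim ≥ 3. Nothing in this file proves a case of the Hodge conjecture for an abelian variety; `HC_CM`
(`RankFourFaces.CMAbelianHodge`) is a HYPOTHESIS of the two `HC_AV` rows, load-bearing as typed; item `Theses.RankFourFaces.CMToAbelian`
(stmt-16267) OPEN and not closed here. Seat `pub-hodge-ring2-ab-andre-2`, gen 16.

## What is proved (theorems only; no definition, no named fact, no sorry)

Two DISPLAY-ONLY brackets (`local notation3`, no `def`, not census nodes — REFEREE-AB F-ab-103; typed as nodes only on LEAD's word):
* `CMWeights[]` — every compact pencil of abelian varieties carries, at each CM point `t`, a locally quasi-finite endomorphism `ν` and a weight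
  base `N ≥ 2` with the Leray weights (wt), (wt₃), (top) of part XXIV-a in every degree. A PRINT THEOREM for `ν = θ_N` (Kleiman 1968 p. 374;
  Milne 2020, proof of Prop. 1; Deninger–Murre 1991 Thm. 3.1; a compact pencil is an abelian scheme, Mumford GIT 6.14) not yet in the tree.
* `CMTopWeightLifts[]` — at CM points of such weighted pencils, every class of `𝒳` of top weight in positive even degree whose restriction to
  `X_t` is algebraic IS algebraic ("the canonical = flat lifts of the algebraic classes of the CM fibre are algebraic"). OPEN.
Rows: **`cmTopWeightLifts_of_cmFibreAlgebraicLift`** ((L) ⟹ bracket, K), **`cmFibreAlgebraicLift_of_cmTopWeightLifts`** (bracket ⟹ (L),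
K[`CMWeights[]`]), **`cmFibreAlgebraicLift_iff_cmTopWeightLifts`**, on-path **`cmTopWeightLifts_of_HC_AV_of_verdier`** (K[Verdier]),
**`HC_AV_of_HC_CM_of_cmTopWeightLifts`** (binders [h₂₁], `CMWeights[]`, `HC_CM`, bracket — in this order),
**`HC_AV_iff_HC_CM_and_cmTopWeightLifts_of_verdier`** (mod [h₂₁, Verdier, `CMWeights[]`]); §7 the W₆ row in weight form
**`weilSixfolds_of_cmPowerWeilPencilsAt_of_topWeightLifts`** (`(W_E)₃ ∧ [weights and top-weight lifts at the E-power points]`, `HC_CM` idle).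

## Honest status

No node is born; nothing is minimal; nothing here is fact-free progress on `HC_AV`; the bracket is one more exact READING of (L) =
`CMFibreAlgebraicLift` (≡ Num^CM ≡ PrimCM ≡ F_CM under `HC_CM`, parts XIX–XXII), granted the print weights: "at a CM fibre of a compact abelian
pencil the canonical (top-weight = flat) lift to the total space of every algebraic class is algebraic" (Milne: `aH^{2r}(A_t)^π =
j_t^* aH⁰(S, R^{2r} f_*)`). References: Milne2020HodgeClassesAV (proof of Prop. 1, pp. 7–8); Kleiman1968AlgebraicCycles (p. 374);
DeningerMurre1991 (Thm. 3.1); Andre1996Motifs (§5.1, Lemme 6.3.1, §6.3 Remarque 2); Verdier1976 (Cor. 5.1); MumfordGIT (Thm. 6.14).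
-/

noncomputable section

set_option linter.dupNamespace false

namespace Summit.HodgeConjecture.HodgeConjecture.Ring2.AbelianAll

open CategoryTheory AlgebraicGeometry
open Literature.AlgebraicGeometry Literature.AlgebraicGeometry.Motives
open Literature.AlgebraicGeometry.HodgeTheory
open Literature.AlgebraicGeometry.Deligne1982 (cmLocus)
open Literature.AlgebraicGeometry.Andre1996 (andre1996_cmAnchoredPencil)
open Summit.HodgeConjecture.HodgeConjecture
open Summit.HodgeConjecture.HodgeConjecture.Theses
open Summit.HodgeConjecture.HodgeConjecture.Ring2.Deform (HC_CM_of_HC_AV)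
open Summit.HodgeConjecture.HodgeConjecture.Ring2.Hypotheses (cmPowerLocus)

/-! ## §6 Node level (display-only brackets): `CMWeights[]`, `CMTopWeightLifts[]` and the `HC_AV` rows -/

section Nodes

/-- DISPLAY-ONLY bracket (no `def`, not a census node — REFEREE-AB F-ab-103): **every compact pencil of abelian varieties carries, at each CM
point `t`, a locally quasi-finite endomorphism `ν` and a weight base `N ≥ 2` with the Leray weights (wt), (wt₃), (top) in every degree.** A
PRINT THEOREM (`ν = θ_N`: Kleiman 1968 p. 374, Milne 2020 proof of Prop. 1, Deninger–Murre 1991 Thm. 3.1; a compact pencil is an abelian scheme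
by Mumford GIT 6.14) that the tree does not yet prove; displayed as a hypothesis. -/
local notation3 (prettyPrint := false) "CMWeights[]" =>
  ∀ ⦃d : ℕ⦄ ⦃𝒳 S : SchemeOver ℂ⦄ (f : 𝒳 ⟶ S), IsCompactAbelianPencil f d → ∀ t ∈ cmLocus f d,
    ∃ (ν : 𝒳 ⟶ 𝒳) (_ : LocallyQuasiFinite ν.left) (N : ℕ), 2 ≤ N ∧
      (∀ (k : ℕ) (w : complexBetti 𝒳 k), complexBetti.map (fiberι f t) k (complexBetti.map ν k w) =
        ((N : ℂ) ^ k) • complexBetti.map (fiberι f t) k w) ∧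
      (∀ (k k₁ k₂ : ℕ), k₁ + 1 = k → k₂ + 1 = k₁ → ∀ w : complexBetti 𝒳 k, ∃ w₀ w₁ w₂ : complexBetti 𝒳 k,
        w = w₀ + w₁ + w₂ ∧ complexBetti.map ν k w₀ = ((N : ℂ) ^ k) • w₀ ∧ complexBetti.map ν k w₁ = ((N : ℂ) ^ k₁) • w₁ ∧
        complexBetti.map ν k w₂ = ((N : ℂ) ^ k₂) • w₂) ∧
      (∀ (k : ℕ) (G : complexBetti 𝒳 k), complexBetti.map ν k G = ((N : ℂ) ^ k) • G →
        complexBetti.map (fiberι f t) k G = 0 → G = 0)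

/-- DISPLAY-ONLY bracket (no `def`, not a census node — REFEREE-AB F-ab-103): **CM TOP-WEIGHT LIFTS** — on every compact pencil of abelian
varieties, at every CM point `t`, for every locally quasi-finite endomorphism `ν` and weight base `N ≥ 2` with the Leray weights in every degree:
every class of `𝒳` of top weight in positive even degree whose restriction to `X_t` is algebraic IS algebraic ("the canonical lifts of the
algebraic classes of the CM fibre are algebraic"; Milne: `aH^{2r}(A_t)^π = j_t^* aH⁰(S, R^{2r} f_*)`). OPEN; a HYPOTHESIS wherever used. -/
local notation3 (prettyPrint := false) "CMTopWeightLifts[]" =>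
  ∀ ⦃d : ℕ⦄ ⦃𝒳 S : SchemeOver ℂ⦄ (f : 𝒳 ⟶ S), IsCompactAbelianPencil f d → ∀ t ∈ cmLocus f d,
    ∀ (ν : 𝒳 ⟶ 𝒳) (_ : LocallyQuasiFinite ν.left) (N : ℕ), 2 ≤ N →
      (∀ (k : ℕ) (w : complexBetti 𝒳 k), complexBetti.map (fiberι f t) k (complexBetti.map ν k w) =
        ((N : ℂ) ^ k) • complexBetti.map (fiberι f t) k w) →
      (∀ (k k₁ k₂ : ℕ), k₁ + 1 = k → k₂ + 1 = k₁ → ∀ w : complexBetti 𝒳 k, ∃ w₀ w₁ w₂ : complexBetti 𝒳 k,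
        w = w₀ + w₁ + w₂ ∧ complexBetti.map ν k w₀ = ((N : ℂ) ^ k) • w₀ ∧ complexBetti.map ν k w₁ = ((N : ℂ) ^ k₁) • w₁ ∧
        complexBetti.map ν k w₂ = ((N : ℂ) ^ k₂) • w₂) →
      (∀ (k : ℕ) (G : complexBetti 𝒳 k), complexBetti.map ν k G = ((N : ℂ) ^ k) • G →
        complexBetti.map (fiberι f t) k G = 0 → G = 0) →
      ∀ (p : ℕ) (y₀ : complexBetti 𝒳 (2 * (p + 1))),
        complexBetti.map ν (2 * (p + 1)) y₀ = ((N : ℂ) ^ (2 * (p + 1))) • y₀ →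
        complexBetti.map (fiberι f t) (2 * (p + 1)) y₀ ∈ algebraicClasses (fiberOver f t) (p + 1) →
        y₀ ∈ algebraicClasses 𝒳 (p + 1)

/-- **(L) ⟹ [CM top-weight lifts]** — on any weighted pencil the canonical lift of an algebraic class of the CM fibre is algebraic as soon as
SOME algebraic lift exists (§4, ⟹); no weights hypothesis at node level (they are premises of the bracket). [cite: Milne2020HodgeClassesAV, proof of Prop. 1 (pp. 7–8)]
[cite: Andre1996Motifs, §5.1 (p. 25)] -/
theorem cmTopWeightLifts_of_cmFibreAlgebraicLift (hL : CMFibreAlgebraicLift) : CMTopWeightLifts[] := by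
  intro d 𝒳 S f hf t ht ν _ N hN hwt hwt₃ htop p y₀ hy₀ halg
  exact (comap_le_sup_iff_forall_topWeight_mem hf t ν hN (hwt _) (hwt₃ (2 * (p + 1)) (2 * p + 1) (2 * p) (by omega) (by omega))
    (htop _)).1 (cmFibreAlgebraicLift_iff_comap_le_sup.1 hL f hf (p + 1) t ht) y₀ hy₀ halg

/-- **[CM top-weight lifts] ⟹ (L), granted `CMWeights[]`** (§4, ⟸, at the weighted endomorphism the bracket supplies; degree `0` is the tree's
`comap_le_sup_of_extreme`). [cite: Milne2020HodgeClassesAV, proof of Prop. 1 (pp. 7–8)] [cite: Andre1996Motifs, §5.1 (p. 25)] -/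
theorem cmFibreAlgebraicLift_of_cmTopWeightLifts (hW : CMWeights[]) (h : CMTopWeightLifts[]) : CMFibreAlgebraicLift := by
  refine cmFibreAlgebraicLift_iff_comap_le_sup.2 fun d 𝒳 S f hf p t ht ↦ ?_
  cases p with
  | zero => exact comap_le_sup_of_extreme hf t (show 0 + d = d by omega) (Or.inl (by omega))
  | succ p =>
    obtain ⟨ν, _, N, hN, hwt, hwt₃, htop⟩ := hW f hf t ht
    exact (comap_le_sup_iff_forall_topWeight_mem hf t ν hN (hwt _) (hwt₃ (2 * (p + 1)) (2 * p + 1) (2 * p) (by omega) (by omega))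
      (htop _)).2 (h f hf t ht ν inferInstance N hN hwt hwt₃ htop p)

/-- **(L) ⟺ [CM top-weight lifts], granted `CMWeights[]`.** One more exact reading of the André-axis lift beside Num^CM / PrimCM / F_CM:
"the canonical (flat) lifts of the algebraic classes of the CM fibres are algebraic". [cite: Milne2020HodgeClassesAV, proof of Prop. 1 (pp. 7–8)]
[cite: Andre1996Motifs, §5.1 (p. 25) and §6.3 (p. 33)] -/
theorem cmFibreAlgebraicLift_iff_cmTopWeightLifts (hW : CMWeights[]) : CMFibreAlgebraicLift ↔ CMTopWeightLifts[] :=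
  ⟨cmTopWeightLifts_of_cmFibreAlgebraicLift, cmFibreAlgebraicLift_of_cmTopWeightLifts hW⟩

/-- **ON-PATH: `HC_AV` ⟹ [CM top-weight lifts]** (granted Verdier 1976 for the spreading step of part XX; NO weights hypothesis).
[cite: Verdier1976, Cor. 5.1] [cite: Milne2020HodgeClassesAV, proof of Prop. 1 (pp. 7–8)] -/
theorem cmTopWeightLifts_of_HC_AV_of_verdier (hGT : Verdier1976_genericLocalTriviality)
    (h : PadicSemiregularLift.HodgeAbelianVarieties) : CMTopWeightLifts[] :=
  cmTopWeightLifts_of_cmFibreAlgebraicLift (cmFibreAlgebraicLift_of_HC_AV_of_verdier hGT h)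

/-- **`HC_CM ∧ [CM top-weight lifts] ⟹ HC_AV`, granted [h₂₁] and `CMWeights[]`** (binders in this order; `HC_CM` = `RankFourFaces.CMAbelianHodge`
a HYPOTHESIS, load-bearing). research route, not a corollary; conditional on HC_CM plus one named minimal statement.
[cite: Andre1996Motifs, Lemme 6.3.1 (p. 31) and Remarque 2 (p. 33)] [cite: Milne2020HodgeClassesAV, proof of Prop. 1 (pp. 7–8)] -/
theorem HC_AV_of_HC_CM_of_cmTopWeightLifts (h₂₁ : andre1996_cmAnchoredPencil) (hW : CMWeights[])
    (hCM : RankFourFaces.CMAbelianHodge) (h : CMTopWeightLifts[]) : PadicSemiregularLift.HodgeAbelianVarieties :=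
  HC_AV_of_HC_CM_and_cmFibreAlgebraicLift h₂₁ hCM (cmFibreAlgebraicLift_of_cmTopWeightLifts hW h)

/-- **EXACTNESS: `HC_AV ⟺ HC_CM ∧ [CM top-weight lifts]`, granted [h₂₁], Verdier and `CMWeights[]`.**
[cite: Andre1996Motifs, Lemme 6.3.1 (p. 31) and Remarque 2 (p. 33)] [cite: Verdier1976, Cor. 5.1] [cite: Milne2020HodgeClassesAV, proof of Prop. 1 (pp. 7–8)] -/
theorem HC_AV_iff_HC_CM_and_cmTopWeightLifts_of_verdier (h₂₁ : andre1996_cmAnchoredPencil)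
    (hGT : Verdier1976_genericLocalTriviality) (hW : CMWeights[]) :
    PadicSemiregularLift.HodgeAbelianVarieties ↔ (RankFourFaces.CMAbelianHodge ∧ CMTopWeightLifts[]) :=
  ⟨fun h ↦ ⟨HC_CM_of_HC_AV h, cmTopWeightLifts_of_HC_AV_of_verdier hGT h⟩,
    fun h ↦ HC_AV_of_HC_CM_of_cmTopWeightLifts h₂₁ hW h.1 h.2⟩

end Nodes

/-! ## §7 W₆ in weight form: top-weight lifts at the `E`-power points of compact sextic Weil pencils -/

section Weil

/-- **`(W_E)₃ ∧ [at the `E`-power points `t` of the compact pencils of abelian sixfolds: the pencil carries a weighted endomorphism at `t`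
(print: `θ_N`) and every top-weight class of the SEVENFOLD of positive even degree whose restriction to `X_t ≅ E⁶` is algebraic IS algebraic]
⟹ WeilSixfolds`** — the Weil-sixfold item of route `SevenfoldWeilCensus` in weight form, through §4 and parts XXII-d / XXI-b §7 / XIX-f
(`forall_comap_le_sup_iff_primitiveLift`, `weilSixfolds_of_cmPowerWeilPencilsAt_of_primitiveLiftE`). FIND-THE-CYCLE (large monodromy): the
canonical lifts `w̃₁, w̃₂ ∈ H⁶(𝒳⁷)` of the two Weil classes of `E⁶` — the weight-`N⁶` classes restricting to them — must be algebraic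
3-cycles on the sevenfold. `HC_CM` IDLE; no named fact; `(W_E)₃` is an OPEN habitat node. research route, not a corollary; conditional on
HC_CM plus one named minimal statement. [cite: Milne2020HodgeClassesAV, proof of Prop. 1 (pp. 7–8)] [cite: vanGeemen1994HodgeAV, Thm. 6.12]
[cite: Andre1996Motifs, Lemme 6.3.3 (p. 33)] -/
theorem weilSixfolds_of_cmPowerWeilPencilsAt_of_topWeightLifts (hW : CMPowerAnchoredCompactWeilPencilsAt 3)
    (h : ∀ ⦃𝒳 S : SchemeOver ℂ⦄ (f : 𝒳 ⟶ S) (_ : IsCompactAbelianPencil f 6) (t : ComplexPoints S), t ∈ cmPowerLocus f 6 →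
      ∃ (ν : 𝒳 ⟶ 𝒳) (_ : LocallyQuasiFinite ν.left) (N : ℕ), 2 ≤ N ∧
        (∀ (k : ℕ) (w : complexBetti 𝒳 k), complexBetti.map (fiberι f t) k (complexBetti.map ν k w) =
          ((N : ℂ) ^ k) • complexBetti.map (fiberι f t) k w) ∧
        (∀ (k k₁ k₂ : ℕ), k₁ + 1 = k → k₂ + 1 = k₁ → ∀ w : complexBetti 𝒳 k, ∃ w₀ w₁ w₂ : complexBetti 𝒳 k,
          w = w₀ + w₁ + w₂ ∧ complexBetti.map ν k w₀ = ((N : ℂ) ^ k) • w₀ ∧ complexBetti.map ν k w₁ = ((N : ℂ) ^ k₁) • w₁ ∧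
          complexBetti.map ν k w₂ = ((N : ℂ) ^ k₂) • w₂) ∧
        (∀ (k : ℕ) (G : complexBetti 𝒳 k), complexBetti.map ν k G = ((N : ℂ) ^ k) • G →
          complexBetti.map (fiberι f t) k G = 0 → G = 0) ∧
        ∀ (p : ℕ) (y₀ : complexBetti 𝒳 (2 * (p + 1))),
          complexBetti.map ν (2 * (p + 1)) y₀ = ((N : ℂ) ^ (2 * (p + 1))) • y₀ →
          complexBetti.map (fiberι f t) (2 * (p + 1)) y₀ ∈ algebraicClasses (fiberOver f t) (p + 1) →
          y₀ ∈ algebraicClasses 𝒳 (p + 1)) :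
    Theses.SevenfoldWeilCensus.WeilSixfolds := by
  refine weilSixfolds_of_cmPowerWeilPencilsAt_of_primitiveLiftE hW ?_
  intro 𝒳 S f hf t ht K hKalg hKs r h2r hrd ξ hξ hP hI
  obtain ⟨ν, _, N, hN, hwt, hwt₃, htop, hlift⟩ := h f hf t ht
  have hL : ∀ p : ℕ, (algebraicClasses (fiberOver f t) p).comap (complexBetti.map (fiberι f t) (2 * p)).hom ≤
      algebraicClasses 𝒳 p ⊔ LinearMap.ker (complexBetti.map (fiberι f t) (2 * p)).hom := by
    intro p
    cases p with
    | zero => exact comap_le_sup_of_extreme hf t (show 0 + 6 = 6 by omega) (Or.inl (by omega))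
    | succ p =>
      exact (comap_le_sup_iff_forall_topWeight_mem hf t ν hN (hwt _)
        (hwt₃ (2 * (p + 1)) (2 * p + 1) (2 * p) (by omega) (by omega)) (htop _)).2 (hlift p)
  exact (forall_comap_le_sup_iff_primitiveLift hf t hKalg hKs).1 hL r h2r hrd ξ hξ hP hI

end Weil

end Summit.HodgeConjecture.HodgeConjecture.Ring2.AbelianAll

end
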